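import Summits.AnomalousDissipation.AnomalousDissipation.Theorems.NoScreening.Negative.StirHalfShift
import Summits.AnomalousDissipation.AnomalousDissipation.Theorems.MomentParityQuarticGateDesignSymShiftOp
import Literature.Analysis.FluidPDE.StatisticalSolutionDirac
import Literature.Analysis.FluidPDE.LerayHopfGalileanTorusTools
import Literature.Analysis.FunctionSpaces.TorusSobolevSpaceProofs

/-!
# Negative knowledge for the crux `StirringSphere.NoScreening` (stmt-AnomalousDissipation-17144), part 2/2:
# the crux contains a ν-UNIFORM UNIVERSAL INJECTION FLOOR for the steady states of ONE fixed force

Strategist seat `planner-cstrat-stmt-AnomalousDissipation-17144-r1-0` (2026-08-17, second-opinion census).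
Everything here is sorry-free and asserts no Theses statement; it certifies, in Lean, the reduction that both
strategy censuses of the crux rest on (census b1, `Cruxes/NoScreening/STRATEGY-CENSUS.md`, left it as the
`sorry`s `not_noScreening_of_steadyMixtures` / `polarFloor_of_noScreening` of `KleinPoleSketch.lean`).

MAIN THEOREM `steadyPolarInjectionFloor_of_noScreening`: `NoScreening →` for the route's literal triple
`b = (b₀, b₁, b₂)` and every energy level `E` there are `ν₀, m₀ > 0` such that for every sign `s = ±1`, every
`ν ∈ (0, ν₀)` and EVERY steady weak solution `u ∈ V` of `NS_ν(s • b₂)`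
(`b₂ = sin 2π(x₂+x₃) e₁ + sin 2π(x₃+x₁) e₂ + sin 2π(x₁+x₂) e₃`, the pole `c = s • e₂` of the stirring sphere)
obeying the energy inequality `ν‖∇u‖² ≤ (u, s • b₂)` and `‖u‖² ≤ E`, the injected power is bounded below:
`m₀ ≤ (u, s • b₂)`.  In words: the rank-2 crux asserts, among other things, that NO bounded steady state of the
single force `∓b₂` is quiet, uniformly as `ν → 0` — a universal zeroth-law-type floor for one explicit force,
stronger in kind than the (existential) summit clause, whose `ν = 0` endpoint is false by the explicit smooth
Euler-balanced state `u* = (2π)^{-1/2}(b₁ + b₁′)` (`(u*·∇)u* + ∇q = −b₂`, `(u*, b₂) = 0`; census §Negation) and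
which is numerically false at every tested `ν ∈ [0.0012, 0.02]` (quiet steady branch `u_ν → u*`, dissipation
≈ 18.5 ν, energy ≈ 0.46; kit jobs j024442 / j024349 / j025559 / j026477 attached to the item).

PROOF (the "pinned pole" symmetrisation, no topology): the half-lattice shift `τ_h`, `h = (½,½,½)`, negates
`b₀, b₁` (shell `|k|² = 1`) and fixes `b₂` (shell `|k|² = 2`) — `stir_parity` (part 1/2); translation acts on
`H` by homeomorphisms (`MomentParityQuarticGate.exists_shiftOp`, landed) preserving `V`, the norm, the
enstrophy and — for an `h`-periodic force — steady weak solutions and their energy inequality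
(`isSteadyWeakSolution_shiftOp`, here); Dirac masses at such steady states are Foias–Prodi statistics (tree:
`IsSteadyWeakSolution.isStationaryStatisticalSolution_dirac`) and so is their midpoint `μ̄ = ½(δ_u + δ_{τ_h u})`
(`isStationaryStatisticalSolution_halfDiracPair`, part 1/2); `μ̄` has energy `‖u‖²` and response
`y(μ̄) = (0, 0, (u, b₂))`; `NoScreening` at `c = s • e₂` gives `m₀² ≤ (u, b₂)²`, and the energy inequality fixes
the sign.  COROLLARY `not_noScreening_of_quietPolarSteadyStates`: a family of bounded admissible steady states
of `NS_ν(±b₂)` with vanishing injection along `ν → 0` refutes the crux.  CONDITIONAL MEASURE-LEVEL VERSION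
`polarInjectionFloor_of_noScreening` (+ corollary `not_noScreening_of_quietPolarStatistics`): under the two
bookkeeping stubs of the sibling line `Cruxes/HairyBallAlignment/Lines/pole.lean` (translation covariance and
midpoint convexity of the bounded Foias–Prodi class, hypotheses restated verbatim) the same floor holds for
EVERY bounded Foias–Prodi statistics of `NS_ν(±b₂)` (census b1's `PolarUniversalInjectionFloor`, both poles).

## References
* C. Foias, O. Manley, R. Rosa, R. Temam, *Navier–Stokes Equations and Turbulence* (CUP 2001), Ch. IV §1.2
  Def. 1.3 and the remark pp. 181–182 (Dirac masses at steady states). [FMRTTurbulence2001]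
-/

noncomputable section

set_option linter.dupNamespace false

namespace Summit.AnomalousDissipation.AnomalousDissipation.Theorems.NoScreening.Negative

open MeasureTheory Filter
open scoped InnerProductSpace RealInnerProductSpace ENNReal NNReal BigOperators
open Literature.Analysis.FunctionSpaces Literature.Analysis.FluidPDE
open Summit.AnomalousDissipation.AnomalousDissipation.Theses.StirringSphere
open Summit.AnomalousDissipation.AnomalousDissipation.Theorems.MomentParityQuarticGate

/-! ## Covariance of `V`, of steady weak solutions and of their energy inequality under translations of `H` -/

section Covariance

variable {T : UnitAddTorus (Fin 3) → Torus.energySpace (Fin 3) ≃ₜ Torus.energySpace (Fin 3)}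
  (hT : ∀ (a : UnitAddTorus (Fin 3)) (u : Torus.energySpace (Fin 3)),
    (((T a u).1 : Lp (EuclideanSpace ℝ (Fin 3)) 2 (volume : Measure (UnitAddTorus (Fin 3)))) :
        UnitAddTorus (Fin 3) → EuclideanSpace ℝ (Fin 3)) =ᵐ[volume]
      fun x => ((u.1 : Lp (EuclideanSpace ℝ (Fin 3)) 2 (volume : Measure (UnitAddTorus (Fin 3)))) :
        UnitAddTorus (Fin 3) → EuclideanSpace ℝ (Fin 3)) (x + a))

include hT

/-- **Translation preserves `V = H ∩ H¹`.** [folklore] -/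
theorem mem_energySpaceV_shiftOp (a : UnitAddTorus (Fin 3)) {u : Torus.energySpace (Fin 3)}
    (hV : (u.1 : Lp (EuclideanSpace ℝ (Fin 3)) 2 (volume : Measure (UnitAddTorus (Fin 3)))) ∈ Torus.energySpaceV (Fin 3)) :
    ((T a u).1 : Lp (EuclideanSpace ℝ (Fin 3)) 2 (volume : Measure (UnitAddTorus (Fin 3)))) ∈ Torus.energySpaceV (Fin 3) := by
  refine ⟨(T a u).2, ?_⟩
  have h' : (EuclideanSpace.complexify ∘ ((((T a u).1 : Lp (EuclideanSpace ℝ (Fin 3)) 2 (volume : Measure (UnitAddTorus (Fin 3))))) :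
        UnitAddTorus (Fin 3) → EuclideanSpace ℝ (Fin 3))) =ᵐ[volume]
      fun x => (EuclideanSpace.complexify ∘ (((u.1 : Lp (EuclideanSpace ℝ (Fin 3)) 2 (volume : Measure (UnitAddTorus (Fin 3))))) :
        UnitAddTorus (Fin 3) → EuclideanSpace ℝ (Fin 3))) (x + a) :=
    (hT a u).mono fun x hx => by
      show EuclideanSpace.complexify _ = EuclideanSpace.complexify _
      rw [hx]
  exact (Literature.Analysis.FunctionSpaces.Torus.memSobolev_congr_of_ae_eq h').2
    (Literature.Analysis.FluidPDE.Torus.memSobolev_comp_add_right hV.2 a)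

/-- **Steady weak solutions of an `a`-periodic force are translation covariant.** [folklore] -/
theorem isSteadyWeakSolution_shiftOp {ν : ℝ} {f : UnitAddTorus (Fin 3) → EuclideanSpace ℝ (Fin 3)}
    {a : UnitAddTorus (Fin 3)} (hf : ∀ x, f (x + a) = f x) {u : Torus.energySpace (Fin 3)}
    (hu : Torus.IsSteadyWeakSolution ν f u) : Torus.IsSteadyWeakSolution ν f (T a u) := by
  intro w hw hd hm
  rw [nsGeneratorPairing_shiftOp hT ν hf]
  have e : (fun x => w (x - a)) = fun x => w (x + -a) := funext fun x => by rw [sub_eq_add_neg]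
  rw [e]
  exact hu _ (hw.comp_add_right (-a)) (isDivFree_comp_add_right hd (-a)) (hasZeroMean_comp_add_right hm (-a))

/-- **The energy inequality of a steady state of an `a`-periodic force is translation invariant.** [folklore] -/
theorem energyIneq_shiftOp {ν : ℝ} {f : UnitAddTorus (Fin 3) → EuclideanSpace ℝ (Fin 3)}
    {a : UnitAddTorus (Fin 3)} (hf : ∀ x, f (x + a) = f x) {u : Torus.energySpace (Fin 3)}
    (hE : ν * (Torus.eGradNormSq (((u.1 : Lp (EuclideanSpace ℝ (Fin 3)) 2 (volume : Measure (UnitAddTorus (Fin 3))))) :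
        UnitAddTorus (Fin 3) → EuclideanSpace ℝ (Fin 3))).toReal ≤
      Torus.pairing (u.1 : Lp (EuclideanSpace ℝ (Fin 3)) 2 (volume : Measure (UnitAddTorus (Fin 3)))) f) :
    ν * (Torus.eGradNormSq ((((T a u).1 : Lp (EuclideanSpace ℝ (Fin 3)) 2 (volume : Measure (UnitAddTorus (Fin 3))))) :
        UnitAddTorus (Fin 3) → EuclideanSpace ℝ (Fin 3))).toReal ≤
      Torus.pairing ((T a u).1 : Lp (EuclideanSpace ℝ (Fin 3)) 2 (volume : Measure (UnitAddTorus (Fin 3)))) f := by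
  rw [eGradNormSq_shiftOp hT, pairing_shiftOp hT]
  have hf' : (fun x => f (x - a)) = f := funext fun x => by
    have := hf (x - a)
    rw [sub_add_cancel] at this
    exact this.symm
  rwa [hf']

end Covariance

/-! ## The steady polar injection floor contained in `NoScreening` -/

/-- **MAIN THEOREM — `NoScreening` contains the ν-UNIFORM UNIVERSAL INJECTION FLOOR FOR STEADY STATES AT THE
POLES `±e₂`.** For the route's literal stirring triple `b` and every energy level `E` there are `ν₀, m₀ > 0` such
that for every sign `s = ±1`, every `ν ∈ (0, ν₀)` and EVERY steady weak solution `u ∈ V` of `NS_ν(s • b₂)`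
satisfying the energy inequality `ν‖∇u‖² ≤ (u, s • b₂)` (an equality for `u ∈ V`, Temam) and `‖u‖² ≤ E`, the
injected power obeys `(u, s • b₂) ≥ m₀`: no bounded steady state of the single force `±b₂` is quiet, uniformly as
`ν → 0`.  Proof: symmetrise the Dirac mass at `u` by the half-lattice shift (`½(δ_u + δ_{τ_h u})` is a bounded
Foias–Prodi statistics of the same force with response `(0, 0, (u, b₂))`) and apply the crux at `c = s • e₂`.
[cite: FMRTTurbulence2001, Ch. IV §1.2 Def. 1.3 and remark pp. 181–182] -/
theorem steadyPolarInjectionFloor_of_noScreening (hNS : NoScreening) :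
    ∀ b : Fin 3 → UnitAddTorus (Fin 3) → EuclideanSpace ℝ (Fin 3), b = ![(fun x : UnitAddTorus (Fin 3) => (Literature.Analysis.FluidPDE.Torus.stokesMode (Pi.single (2 : Fin 3) (1 : ℤ)) (EuclideanSpace.single (0 : Fin 3) (1 : ℝ)) false x + Literature.Analysis.FluidPDE.Torus.stokesMode (Pi.single (0 : Fin 3) (1 : ℤ)) (EuclideanSpace.single (1 : Fin 3) (1 : ℝ)) false x + Literature.Analysis.FluidPDE.Torus.stokesMode (Pi.single (1 : Fin 3) (1 : ℤ)) (EuclideanSpace.single (2 : Fin 3) (1 : ℝ)) false x : EuclideanSpace ℝ (Fin 3))), (fun x : UnitAddTorus (Fin 3) => (Literature.Analysis.FluidPDE.Torus.stokesMode (Pi.single (1 : Fin 3) (1 : ℤ)) (EuclideanSpace.single (0 : Fin 3) (1 : ℝ)) true x + Literature.Analysis.FluidPDE.Torus.stokesMode (Pi.single (2 : Fin 3) (1 : ℤ)) (EuclideanSpace.single (1 : Fin 3) (1 : ℝ)) true x + Literature.Analysis.FluidPDE.Torus.stokesMode (Pi.single (0 : Fin 3) (1 : ℤ)) (EuclideanSpace.single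 (2 : Fin 3) (1 : ℝ)) true x : EuclideanSpace ℝ (Fin 3))), (fun x : UnitAddTorus (Fin 3) => (Literature.Analysis.FluidPDE.Torus.stokesMode ![(0 : ℤ), 1, 1] (EuclideanSpace.single (0 : Fin 3) (1 : ℝ)) false x + Literature.Analysis.FluidPDE.Torus.stokesMode ![(1 : ℤ), 0, 1] (EuclideanSpace.single (1 : Fin 3) (1 : ℝ)) false x + Literature.Analysis.FluidPDE.Torus.stokesMode ![(1 : ℤ), 1, 0] (EuclideanSpace.single (2 : Fin 3) (1 : ℝ)) false x : EuclideanSpace ℝ (Fin 3)))] →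
    ∀ E : ℝ, 0 < E → ∃ ν₀ m₀ : ℝ, 0 < ν₀ ∧ 0 < m₀ ∧ ∀ s : ℝ, (s = 1 ∨ s = -1) → ∀ ν : ℝ, 0 < ν → ν < ν₀ →
      ∀ u : Torus.energySpace (Fin 3),
        (u.1 : Lp (EuclideanSpace ℝ (Fin 3)) 2 (volume : Measure (UnitAddTorus (Fin 3)))) ∈ Torus.energySpaceV (Fin 3) →
        Torus.IsSteadyWeakSolution ν (fun x => s • b 2 x) u →
        ν * (Torus.eGradNormSq (((u.1 : Lp (EuclideanSpace ℝ (Fin 3)) 2 (volume : Measure (UnitAddTorus (Fin 3))))) :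
            UnitAddTorus (Fin 3) → EuclideanSpace ℝ (Fin 3))).toReal ≤
          Torus.pairing (u.1 : Lp (EuclideanSpace ℝ (Fin 3)) 2 (volume : Measure (UnitAddTorus (Fin 3)))) (fun x => s • b 2 x) →
        ‖u‖ ^ 2 ≤ E →
          m₀ ≤ Torus.pairing (u.1 : Lp (EuclideanSpace ℝ (Fin 3)) 2 (volume : Measure (UnitAddTorus (Fin 3)))) (fun x => s • b 2 x) := by
  intro b hb E hE
  obtain ⟨ν₀, m₀, hν₀, hm₀, H⟩ := hNS b hb E hE
  refine ⟨ν₀, m₀, hν₀, hm₀, fun s hs ν hν hνlt u hV hsteady hEineq hbound => ?_⟩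
  -- the half-lattice shift and the parities of the family
  set h : UnitAddTorus (Fin 3) := fun _ => ((2⁻¹ : ℝ) : UnitAddCircle) with hh
  have hpar := stir_parity b hb h hh
  -- the polar force `s • b₂` is `h`-periodic
  have hf : ∀ x, (fun x => s • b 2 x) (x + h) = (fun x => s • b 2 x) x := fun x => by
    show s • b 2 (x + h) = s • b 2 x
    rw [(hpar x).2.2]
  -- translate the steady state by `h`
  obtain ⟨T, hT⟩ := exists_shiftOp
  have hVv : ((T h u).1 : Lp (EuclideanSpace ℝ (Fin 3)) 2 (volume : Measure (UnitAddTorus (Fin 3)))) ∈ Torus.energySpaceV (Fin 3) :=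
    mem_energySpaceV_shiftOp hT h hV
  have hsteadyv : Torus.IsSteadyWeakSolution ν (fun x => s • b 2 x) (T h u) :=
    isSteadyWeakSolution_shiftOp hT hf hsteady
  have hEv := energyIneq_shiftOp hT hf hEineq
  -- the two Dirac statistics and their midpoint
  have hδu := hsteady.isStationaryStatisticalSolution_dirac hV hEineq
  have hδv := hsteadyv.isStationaryStatisticalSolution_dirac hVv hEv
  have hSSS := isStationaryStatisticalSolution_halfDiracPair hδu hδv
  have hInt : Integrable (fun w : Torus.energySpace (Fin 3) => ‖w‖ ^ 2)
      ((2⁻¹ : ℝ≥0∞) • Measure.dirac u + (2⁻¹ : ℝ≥0∞) • Measure.dirac (T h u)) := integrable_halfDiracPair _ _ _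
  have hEn : Torus.ensembleEnergy ((2⁻¹ : ℝ≥0∞) • Measure.dirac u + (2⁻¹ : ℝ≥0∞) • Measure.dirac (T h u)) ≤ E := by
    unfold Torus.ensembleEnergy
    rw [integral_halfDiracPair, norm_shiftOp hT]
    linarith
  -- the crux at the pole `c = s • e₂`
  have hSSS' : Torus.IsStationaryStatisticalSolution ν
      (fun x => ∑ i : Fin 3, (EuclideanSpace.single (2 : Fin 3) s) i • b i x)
      ((2⁻¹ : ℝ≥0∞) • Measure.dirac u + (2⁻¹ : ℝ≥0∞) • Measure.dirac (T h u)) := by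
    rw [force_pole]; exact hSSS
  have key := H (EuclideanSpace.single (2 : Fin 3) s) (norm_pole hs) ν hν hνlt _ hSSS' hInt hEn
  -- the responses of the midpoint: `(0, 0, (u, b₂))`
  have hp : ∀ i : Fin 3,
      ∫ w, Torus.pairing (w : Lp (EuclideanSpace ℝ (Fin 3)) 2 (volume : Measure (UnitAddTorus (Fin 3)))) (b i)
        ∂((2⁻¹ : ℝ≥0∞) • Measure.dirac u + (2⁻¹ : ℝ≥0∞) • Measure.dirac (T h u)) =
      2⁻¹ * Torus.pairing (u.1 : Lp (EuclideanSpace ℝ (Fin 3)) 2 (volume : Measure (UnitAddTorus (Fin 3)))) (b i) +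
        2⁻¹ * Torus.pairing ((T h u).1 : Lp (EuclideanSpace ℝ (Fin 3)) 2 (volume : Measure (UnitAddTorus (Fin 3)))) (b i) :=
    fun i => integral_halfDiracPair
      (fun w : Torus.energySpace (Fin 3) =>
        Torus.pairing (w : Lp (EuclideanSpace ℝ (Fin 3)) 2 (volume : Measure (UnitAddTorus (Fin 3)))) (b i)) u (T h u)
  have p0 : (fun x => b 0 (x - h)) = fun x => - b 0 x := funext fun x => by rw [sub_halfShift h hh, (hpar x).1]
  have p1 : (fun x => b 1 (x - h)) = fun x => - b 1 x := funext fun x => by rw [sub_halfShift h hh, (hpar x).2.1]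
  have p2 : (fun x => b 2 (x - h)) = b 2 := funext fun x => by rw [sub_halfShift h hh, (hpar x).2.2]
  have hv0 : Torus.pairing ((T h u).1 : Lp (EuclideanSpace ℝ (Fin 3)) 2 (volume : Measure (UnitAddTorus (Fin 3)))) (b 0) =
      - Torus.pairing (u.1 : Lp (EuclideanSpace ℝ (Fin 3)) 2 (volume : Measure (UnitAddTorus (Fin 3)))) (b 0) := by
    rw [pairing_shiftOp hT, p0, pairing_fun_neg]
  have hv1 : Torus.pairing ((T h u).1 : Lp (EuclideanSpace ℝ (Fin 3)) 2 (volume : Measure (UnitAddTorus (Fin 3)))) (b 1) =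
      - Torus.pairing (u.1 : Lp (EuclideanSpace ℝ (Fin 3)) 2 (volume : Measure (UnitAddTorus (Fin 3)))) (b 1) := by
    rw [pairing_shiftOp hT, p1, pairing_fun_neg]
  have hv2 : Torus.pairing ((T h u).1 : Lp (EuclideanSpace ℝ (Fin 3)) 2 (volume : Measure (UnitAddTorus (Fin 3)))) (b 2) =
      Torus.pairing (u.1 : Lp (EuclideanSpace ℝ (Fin 3)) 2 (volume : Measure (UnitAddTorus (Fin 3)))) (b 2) := by
    rw [pairing_shiftOp hT, p2]
  rw [Fin.sum_univ_three, hp 0, hp 1, hp 2, hv0, hv1, hv2] at key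
  have key' : m₀ ^ 2 ≤ (Torus.pairing (u.1 : Lp (EuclideanSpace ℝ (Fin 3)) 2 (volume : Measure (UnitAddTorus (Fin 3)))) (b 2)) ^ 2 := by
    nlinarith [key]
  -- `|(u, b₂)| ≥ m₀`
  have habs : m₀ ≤ |Torus.pairing (u.1 : Lp (EuclideanSpace ℝ (Fin 3)) 2 (volume : Measure (UnitAddTorus (Fin 3)))) (b 2)| := by
    rw [← abs_of_pos hm₀]
    exact sq_le_sq.1 key'
  -- the sign: `(u, s • b₂) = s (u, b₂) ≥ ν‖∇u‖² ≥ 0`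
  have hsm : Torus.pairing (u.1 : Lp (EuclideanSpace ℝ (Fin 3)) 2 (volume : Measure (UnitAddTorus (Fin 3)))) (fun x => s • b 2 x) =
      s * Torus.pairing (u.1 : Lp (EuclideanSpace ℝ (Fin 3)) 2 (volume : Measure (UnitAddTorus (Fin 3)))) (b 2) :=
    pairing_const_smul _ s _
  have hnn : 0 ≤ Torus.pairing (u.1 : Lp (EuclideanSpace ℝ (Fin 3)) 2 (volume : Measure (UnitAddTorus (Fin 3)))) (fun x => s • b 2 x) :=
    le_trans (mul_nonneg hν.le ENNReal.toReal_nonneg) hEineq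
  rw [hsm] at hnn ⊢
  rcases hs with rfl | rfl
  · rw [one_mul] at hnn ⊢
    rwa [abs_of_nonneg hnn] at habs
  · have hle : Torus.pairing (u.1 : Lp (EuclideanSpace ℝ (Fin 3)) 2 (volume : Measure (UnitAddTorus (Fin 3)))) (b 2) ≤ 0 := by
      linarith
    rw [abs_of_nonpos hle] at habs
    linarith

/-- **COROLLARY (the refutation criterion).** Quiet bounded admissible steady states of `NS_ν(±b₂)` along
`ν → 0` — at SOME energy level `E`, for every `ν₀, m₀ > 0` a sign `s`, a viscosity `ν ∈ (0, ν₀)` and a steady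
weak solution `u ∈ V` of `NS_ν(s • b₂)` with the energy inequality, `‖u‖² ≤ E` and injection `< m₀` — REFUTE the
crux `NoScreening`.  (The `ν = 0` end of such a family is the explicit smooth Euler state `u* = (2π)^{-1/2}(b₁ + b₁′)`;
its viscous continuation is the open step — census §Negation, crux ideas `klein-pole-quiet-states`,
`tame-kantorovich-shear-triad`.) [cite: FMRTTurbulence2001, Ch. IV §1.2] -/
theorem not_noScreening_of_quietPolarSteadyStates
    (hq : ∀ b : Fin 3 → UnitAddTorus (Fin 3) → EuclideanSpace ℝ (Fin 3), b = ![(fun x : UnitAddTorus (Fin 3) => (Literature.Analysis.FluidPDE.Torus.stokesMode (Pi.single (2 : Fin 3) (1 : ℤ)) (EuclideanSpace.single (0 : Fin 3) (1 : ℝ)) false x + Literature.Analysis.FluidPDE.Torus.stokesMode (Pi.single (0 : Fin 3) (1 : ℤ)) (EuclideanSpace.single (1 : Fin 3) (1 : ℝ)) false x + Literature.Analysis.FluidPDE.Torus.stokesMode (Pi.single (1 : Fin 3) (1 : ℤ)) (EuclideanSpace.single (2 : Fin 3) (1 : ℝ)) false x : EuclideanSpace ℝ (Fin 3))), (fun x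 : UnitAddTorus (Fin 3) => (Literature.Analysis.FluidPDE.Torus.stokesMode (Pi.single (1 : Fin 3) (1 : ℤ)) (EuclideanSpace.single (0 : Fin 3) (1 : ℝ)) true x + Literature.Analysis.FluidPDE.Torus.stokesMode (Pi.single (2 : Fin 3) (1 : ℤ)) (EuclideanSpace.single (1 : Fin 3) (1 : ℝ)) true x + Literature.Analysis.FluidPDE.Torus.stokesMode (Pi.single (0 : Fin 3) (1 : ℤ)) (EuclideanSpace.single (2 : Fin 3) (1 : ℝ)) true x : EuclideanSpace ℝ (Fin 3))), (fun x : UnitAddTorus (Fin 3) => (Literature.Analysis.FluidPDE.Torus.stokesMode ![(0 : ℤ), 1, 1] (EuclideanSpace.single (0 : Fin 3) (1 : ℝ)) false x + Literature.Analysis.FluidPDE.Torus.stokesMode ![(1 : ℤ), 0, 1] (EuclideanSpace.single (1 : Fin 3) (1 : ℝ)) false x + Literature.Analysis.FluidPDE.Torus.stokesMode ![(1 : ℤ), 1, 0] (EuclideanSpace.single (2 : Fin 3) (1 : ℝ)) false x : EuclideanSpace ℝ (Fin 3)))] →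
      ∃ E : ℝ, 0 < E ∧ ∀ ν₀ m₀ : ℝ, 0 < ν₀ → 0 < m₀ →
        ∃ (s ν : ℝ) (u : Torus.energySpace (Fin 3)), (s = 1 ∨ s = -1) ∧ 0 < ν ∧ ν < ν₀ ∧
          (u.1 : Lp (EuclideanSpace ℝ (Fin 3)) 2 (volume : Measure (UnitAddTorus (Fin 3)))) ∈ Torus.energySpaceV (Fin 3) ∧
          Torus.IsSteadyWeakSolution ν (fun x => s • b 2 x) u ∧
          ν * (Torus.eGradNormSq (((u.1 : Lp (EuclideanSpace ℝ (Fin 3)) 2 (volume : Measure (UnitAddTorus (Fin 3))))) :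
              UnitAddTorus (Fin 3) → EuclideanSpace ℝ (Fin 3))).toReal ≤
            Torus.pairing (u.1 : Lp (EuclideanSpace ℝ (Fin 3)) 2 (volume : Measure (UnitAddTorus (Fin 3)))) (fun x => s • b 2 x) ∧
          ‖u‖ ^ 2 ≤ E ∧
          Torus.pairing (u.1 : Lp (EuclideanSpace ℝ (Fin 3)) 2 (volume : Measure (UnitAddTorus (Fin 3)))) (fun x => s • b 2 x) < m₀) :
    ¬ NoScreening := by
  intro hNS
  obtain ⟨E, hE, hq⟩ := hq _ rfl
  obtain ⟨ν₀, m₀, hν₀, hm₀, H⟩ := steadyPolarInjectionFloor_of_noScreening hNS _ rfl E hE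
  obtain ⟨s, ν, u, hs, hν, hνlt, hV, hst, hEi, hbd, hquiet⟩ := hq ν₀ m₀ hν₀ hm₀
  exact absurd (H s hs ν hν hνlt u hV hst hEi hbd) (not_le.2 hquiet)

/-! ## The measure-level floor, conditional on the two bookkeeping stubs of line `HairyBallAlignment/pole` -/

/-- **`NoScreening` ⟹ the ν-UNIFORM UNIVERSAL INJECTION FLOOR AT THE POLES for ALL bounded Foias–Prodi
statistics** (census b1's `PolarUniversalInjectionFloor`, both poles): for the literal triple `b` and every `E` there
are `ν₀, m₀ > 0` such that for `s = ±1`, `ν ∈ (0, ν₀)` and EVERY stationary statistical solution `μ` of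
`NS_ν(s • b₂)` with integrable energy `≤ E`, the mean injected power is `≥ m₀`.  CONDITIONAL on translation
covariance (`hCov`) and midpoint convexity (`hMid`) of the bounded Foias–Prodi class — verbatim the two registered
stubs `stub_shiftCovariance`, `stub_midpointConvexity` of the sibling line `Cruxes/HairyBallAlignment/Lines/pole.lean`
(stmt-AnomalousDissipation-17155); when they land this theorem becomes unconditional by application.
[cite: FMRTTurbulence2001, Ch. IV §1.2 (1.31)] -/
theorem polarInjectionFloor_of_noScreening
    (hCov : ∀ (ν : ℝ) (h : UnitAddTorus (Fin 3)) (f : UnitAddTorus (Fin 3) → EuclideanSpace ℝ (Fin 3))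
      (μ : Measure (Torus.energySpace (Fin 3))),
      Continuous f → (∀ x, f (x + h) = f x) →
      Torus.IsStationaryStatisticalSolution ν f μ →
      Integrable (fun u : Torus.energySpace (Fin 3) => ‖u‖ ^ 2) μ →
        ∃ μ' : Measure (Torus.energySpace (Fin 3)),
          Torus.IsStationaryStatisticalSolution ν f μ' ∧
          Integrable (fun u : Torus.energySpace (Fin 3) => ‖u‖ ^ 2) μ' ∧
          Torus.ensembleEnergy μ' = Torus.ensembleEnergy μ ∧
          ∀ g : UnitAddTorus (Fin 3) → EuclideanSpace ℝ (Fin 3), Continuous g →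
            ∫ u, Torus.pairing (u : Lp (EuclideanSpace ℝ (Fin 3)) 2 (volume : Measure (UnitAddTorus (Fin 3)))) g ∂μ' =
              ∫ u, Torus.pairing (u : Lp (EuclideanSpace ℝ (Fin 3)) 2 (volume : Measure (UnitAddTorus (Fin 3)))) (fun x => g (x + h)) ∂μ)
    (hMid : ∀ (ν : ℝ) (f : UnitAddTorus (Fin 3) → EuclideanSpace ℝ (Fin 3))
      (μ₁ μ₂ : Measure (Torus.energySpace (Fin 3))),
      Continuous f →
      Torus.IsStationaryStatisticalSolution ν f μ₁ → Torus.IsStationaryStatisticalSolution ν f μ₂ →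
      Integrable (fun u : Torus.energySpace (Fin 3) => ‖u‖ ^ 2) μ₁ →
      Integrable (fun u : Torus.energySpace (Fin 3) => ‖u‖ ^ 2) μ₂ →
        ∃ μ₃ : Measure (Torus.energySpace (Fin 3)),
          Torus.IsStationaryStatisticalSolution ν f μ₃ ∧
          Integrable (fun u : Torus.energySpace (Fin 3) => ‖u‖ ^ 2) μ₃ ∧
          Torus.ensembleEnergy μ₃ = (Torus.ensembleEnergy μ₁ + Torus.ensembleEnergy μ₂) / 2 ∧
          ∀ g : UnitAddTorus (Fin 3) → EuclideanSpace ℝ (Fin 3), Continuous g →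
            ∫ u, Torus.pairing (u : Lp (EuclideanSpace ℝ (Fin 3)) 2 (volume : Measure (UnitAddTorus (Fin 3)))) g ∂μ₃ =
              ((∫ u, Torus.pairing (u : Lp (EuclideanSpace ℝ (Fin 3)) 2 (volume : Measure (UnitAddTorus (Fin 3)))) g ∂μ₁) +
                ∫ u, Torus.pairing (u : Lp (EuclideanSpace ℝ (Fin 3)) 2 (volume : Measure (UnitAddTorus (Fin 3)))) g ∂μ₂) / 2)
    (hNS : NoScreening) :
    ∀ b : Fin 3 → UnitAddTorus (Fin 3) → EuclideanSpace ℝ (Fin 3), b = ![(fun x : UnitAddTorus (Fin 3) => (Literature.Analysis.FluidPDE.Torus.stokesMode (Pi.single (2 : Fin 3) (1 : ℤ)) (EuclideanSpace.single (0 : Fin 3) (1 : ℝ)) false x + Literature.Analysis.FluidPDE.Torus.stokesMode (Pi.single (0 : Fin 3) (1 : ℤ)) (EuclideanSpace.single (1 : Fin 3) (1 : ℝ)) false x + Literature.Analysis.FluidPDE.Torus.stokesMode (Pi.single (1 : Fin 3) (1 : ℤ)) (EuclideanSpace.single (2 : Fin 3) (1 : ℝ)) false x : EuclideanSpace ℝ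 (Fin 3))), (fun x : UnitAddTorus (Fin 3) => (Literature.Analysis.FluidPDE.Torus.stokesMode (Pi.single (1 : Fin 3) (1 : ℤ)) (EuclideanSpace.single (0 : Fin 3) (1 : ℝ)) true x + Literature.Analysis.FluidPDE.Torus.stokesMode (Pi.single (2 : Fin 3) (1 : ℤ)) (EuclideanSpace.single (1 : Fin 3) (1 : ℝ)) true x + Literature.Analysis.FluidPDE.Torus.stokesMode (Pi.single (0 : Fin 3) (1 : ℤ)) (EuclideanSpace.single (2 : Fin 3) (1 : ℝ)) true x : EuclideanSpace ℝ (Fin 3))), (fun x : UnitAddTorus (Fin 3) => (Literature.Analysis.FluidPDE.Torus.stokesMode ![(0 : ℤ), 1, 1] (EuclideanSpace.single (0 : Fin 3) (1 : ℝ)) false x + Literature.Analysis.FluidPDE.Torus.stokesMode ![(1 : ℤ), 0, 1] (EuclideanSpace.single (1 : Fin 3) (1 : ℝ)) false x + Literature.Analysis.FluidPDE.Torus.stokesMode ![(1 : ℤ), 1, 0] (EuclideanSpace.single (2 : Fin 3) (1 : ℝ)) false x : EuclideanSpace ℝ (Fin 3)))] →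
    ∀ E : ℝ, 0 < E → ∃ ν₀ m₀ : ℝ, 0 < ν₀ ∧ 0 < m₀ ∧ ∀ s : ℝ, (s = 1 ∨ s = -1) → ∀ ν : ℝ, 0 < ν → ν < ν₀ →
      ∀ μ : Measure (Torus.energySpace (Fin 3)), Torus.IsStationaryStatisticalSolution ν (fun x => s • b 2 x) μ →
        Integrable (fun u : Torus.energySpace (Fin 3) => ‖u‖ ^ 2) μ → Torus.ensembleEnergy μ ≤ E →
          m₀ ≤ ∫ u, Torus.pairing (u : Lp (EuclideanSpace ℝ (Fin 3)) 2 (volume : Measure (UnitAddTorus (Fin 3)))) (fun x => s • b 2 x) ∂μ := by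
  intro b hb E hE
  obtain ⟨ν₀, m₀, hν₀, hm₀, H⟩ := hNS b hb E hE
  refine ⟨ν₀, m₀, hν₀, hm₀, fun s hs ν hν hνlt μ hstat hint hEμ => ?_⟩
  set h : UnitAddTorus (Fin 3) := fun _ => ((2⁻¹ : ℝ) : UnitAddCircle) with hh
  have hpar := stir_parity b hb h hh
  have hcont : Continuous (fun x : UnitAddTorus (Fin 3) => s • b 2 x) := (continuous_stir b hb 2).const_smul s
  have hinv : ∀ x, (fun x => s • b 2 x) (x + h) = (fun x => s • b 2 x) x := fun x => by
    show s • b 2 (x + h) = s • b 2 x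
    rw [(hpar x).2.2]
  -- the translated statistics (stub 1) and the symmetrised statistics (stub 2)
  obtain ⟨μ', hstat', hint', hE', hpair'⟩ := hCov ν h _ μ hcont hinv hstat hint
  obtain ⟨μb, hstatb, hintb, hEb, hpairb⟩ := hMid ν _ μ μ' hcont hstat hstat' hint hint'
  have hEb' : Torus.ensembleEnergy μb ≤ E := by rw [hEb, hE']; linarith
  -- no screening at the pole for the symmetrised statistics
  have hstatb' : Torus.IsStationaryStatisticalSolution ν
      (fun x => ∑ i : Fin 3, (EuclideanSpace.single (2 : Fin 3) s) i • b i x) μb := by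
    rw [force_pole]; exact hstatb
  have hm : m₀ ^ 2 ≤ ∑ i : Fin 3, (∫ u, Torus.pairing (u : Lp (EuclideanSpace ℝ (Fin 3)) 2 (volume : Measure (UnitAddTorus (Fin 3)))) (b i) ∂μb) ^ 2 :=
    H (EuclideanSpace.single (2 : Fin 3) s) (norm_pole hs) ν hν hνlt μb hstatb' hintb hEb'
  -- the three responses of the symmetrised statistics: `(0, 0, y₂(μ))`
  have q0 : (fun x => b 0 (x + h)) = fun x => - b 0 x := funext fun x => (hpar x).1
  have q1 : (fun x => b 1 (x + h)) = fun x => - b 1 x := funext fun x => (hpar x).2.1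
  have q2 : (fun x => b 2 (x + h)) = b 2 := funext fun x => (hpar x).2.2
  have y0 : ∫ u, Torus.pairing (u : Lp (EuclideanSpace ℝ (Fin 3)) 2 (volume : Measure (UnitAddTorus (Fin 3)))) (b 0) ∂μb = 0 := by
    rw [hpairb _ (continuous_stir b hb 0), hpair' _ (continuous_stir b hb 0), q0]
    simp only [pairing_fun_neg, integral_neg]
    ring
  have y1 : ∫ u, Torus.pairing (u : Lp (EuclideanSpace ℝ (Fin 3)) 2 (volume : Measure (UnitAddTorus (Fin 3)))) (b 1) ∂μb = 0 := by
    rw [hpairb _ (continuous_stir b hb 1), hpair' _ (continuous_stir b hb 1), q1]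
    simp only [pairing_fun_neg, integral_neg]
    ring
  have y2 : ∫ u, Torus.pairing (u : Lp (EuclideanSpace ℝ (Fin 3)) 2 (volume : Measure (UnitAddTorus (Fin 3)))) (b 2) ∂μb =
      ∫ u, Torus.pairing (u : Lp (EuclideanSpace ℝ (Fin 3)) 2 (volume : Measure (UnitAddTorus (Fin 3)))) (b 2) ∂μ := by
    rw [hpairb _ (continuous_stir b hb 2), hpair' _ (continuous_stir b hb 2), q2]
    ring
  rw [Fin.sum_univ_three, y0, y1, y2] at hm
  have hy2 : m₀ ^ 2 ≤ (∫ u, Torus.pairing (u : Lp (EuclideanSpace ℝ (Fin 3)) 2 (volume : Measure (UnitAddTorus (Fin 3)))) (b 2) ∂μ) ^ 2 := by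
    simpa using hm
  have habs : m₀ ≤ |∫ u, Torus.pairing (u : Lp (EuclideanSpace ℝ (Fin 3)) 2 (volume : Measure (UnitAddTorus (Fin 3)))) (b 2) ∂μ| := by
    rw [← abs_of_pos hm₀]
    exact sq_le_sq.1 hy2
  -- the injection is nonnegative (mean energy inequality, FMRT IV (1.31)) and equals `s y₂(μ)`
  have hsm : ∫ u, Torus.pairing (u : Lp (EuclideanSpace ℝ (Fin 3)) 2 (volume : Measure (UnitAddTorus (Fin 3)))) (fun x => s • b 2 x) ∂μ =
      s * ∫ u, Torus.pairing (u : Lp (EuclideanSpace ℝ (Fin 3)) 2 (volume : Measure (UnitAddTorus (Fin 3)))) (b 2) ∂μ := by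
    simp_rw [pairing_const_smul]
    exact integral_const_mul s _
  have hnn : 0 ≤ ∫ u, Torus.pairing (u : Lp (EuclideanSpace ℝ (Fin 3)) 2 (volume : Measure (UnitAddTorus (Fin 3)))) (fun x => s • b 2 x) ∂μ := by
    have hmem : MemLp (fun x : UnitAddTorus (Fin 3) => s • b 2 x) 2 volume := ((isSmooth_stir b hb 2).memLp 2).const_smul s
    have h1 := Torus.IsStationaryStatisticalSolution.energy_le_holds hstat hmem
    have h0 : 0 ≤ ν * (Torus.ensembleEnstrophy μ).toReal := mul_nonneg hν.le ENNReal.toReal_nonneg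
    linarith
  rw [hsm] at hnn ⊢
  rcases hs with rfl | rfl
  · rw [one_mul] at hnn ⊢
    rwa [abs_of_nonneg hnn] at habs
  · have hle : ∫ u, Torus.pairing (u : Lp (EuclideanSpace ℝ (Fin 3)) 2 (volume : Measure (UnitAddTorus (Fin 3)))) (b 2) ∂μ ≤ 0 := by
      linarith
    rw [abs_of_nonpos hle] at habs
    linarith

/-- **COROLLARY (measure-level refutation criterion, conditional on the two bookkeeping stubs).** Under
translation covariance and midpoint convexity of the bounded Foias–Prodi class, ANY family of bounded Foias–Prodi
statistics of `NS_ν(±b₂)` with vanishing mean injection along `ν → 0` (steady, time-averaged or otherwise)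
refutes `NoScreening`. [cite: FMRTTurbulence2001, Ch. IV §1.2] -/
theorem not_noScreening_of_quietPolarStatistics
    (hCov : ∀ (ν : ℝ) (h : UnitAddTorus (Fin 3)) (f : UnitAddTorus (Fin 3) → EuclideanSpace ℝ (Fin 3))
      (μ : Measure (Torus.energySpace (Fin 3))),
      Continuous f → (∀ x, f (x + h) = f x) →
      Torus.IsStationaryStatisticalSolution ν f μ →
      Integrable (fun u : Torus.energySpace (Fin 3) => ‖u‖ ^ 2) μ →
        ∃ μ' : Measure (Torus.energySpace (Fin 3)),
          Torus.IsStationaryStatisticalSolution ν f μ' ∧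
          Integrable (fun u : Torus.energySpace (Fin 3) => ‖u‖ ^ 2) μ' ∧
          Torus.ensembleEnergy μ' = Torus.ensembleEnergy μ ∧
          ∀ g : UnitAddTorus (Fin 3) → EuclideanSpace ℝ (Fin 3), Continuous g →
            ∫ u, Torus.pairing (u : Lp (EuclideanSpace ℝ (Fin 3)) 2 (volume : Measure (UnitAddTorus (Fin 3)))) g ∂μ' =
              ∫ u, Torus.pairing (u : Lp (EuclideanSpace ℝ (Fin 3)) 2 (volume : Measure (UnitAddTorus (Fin 3)))) (fun x => g (x + h)) ∂μ)
    (hMid : ∀ (ν : ℝ) (f : UnitAddTorus (Fin 3) → EuclideanSpace ℝ (Fin 3))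
      (μ₁ μ₂ : Measure (Torus.energySpace (Fin 3))),
      Continuous f →
      Torus.IsStationaryStatisticalSolution ν f μ₁ → Torus.IsStationaryStatisticalSolution ν f μ₂ →
      Integrable (fun u : Torus.energySpace (Fin 3) => ‖u‖ ^ 2) μ₁ →
      Integrable (fun u : Torus.energySpace (Fin 3) => ‖u‖ ^ 2) μ₂ →
        ∃ μ₃ : Measure (Torus.energySpace (Fin 3)),
          Torus.IsStationaryStatisticalSolution ν f μ₃ ∧
          Integrable (fun u : Torus.energySpace (Fin 3) => ‖u‖ ^ 2) μ₃ ∧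
          Torus.ensembleEnergy μ₃ = (Torus.ensembleEnergy μ₁ + Torus.ensembleEnergy μ₂) / 2 ∧
          ∀ g : UnitAddTorus (Fin 3) → EuclideanSpace ℝ (Fin 3), Continuous g →
            ∫ u, Torus.pairing (u : Lp (EuclideanSpace ℝ (Fin 3)) 2 (volume : Measure (UnitAddTorus (Fin 3)))) g ∂μ₃ =
              ((∫ u, Torus.pairing (u : Lp (EuclideanSpace ℝ (Fin 3)) 2 (volume : Measure (UnitAddTorus (Fin 3)))) g ∂μ₁) +
                ∫ u, Torus.pairing (u : Lp (EuclideanSpace ℝ (Fin 3)) 2 (volume : Measure (UnitAddTorus (Fin 3)))) g ∂μ₂) / 2)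
    (hq : ∀ b : Fin 3 → UnitAddTorus (Fin 3) → EuclideanSpace ℝ (Fin 3), b = ![(fun x : UnitAddTorus (Fin 3) => (Literature.Analysis.FluidPDE.Torus.stokesMode (Pi.single (2 : Fin 3) (1 : ℤ)) (EuclideanSpace.single (0 : Fin 3) (1 : ℝ)) false x + Literature.Analysis.FluidPDE.Torus.stokesMode (Pi.single (0 : Fin 3) (1 : ℤ)) (EuclideanSpace.single (1 : Fin 3) (1 : ℝ)) false x + Literature.Analysis.FluidPDE.Torus.stokesMode (Pi.single (1 : Fin 3) (1 : ℤ)) (EuclideanSpace.single (2 : Fin 3) (1 : ℝ)) false x : EuclideanSpace ℝ (Fin 3))), (fun x : UnitAddTorus (Fin 3) => (Literature.Analysis.FluidPDE.Torus.stokesMode (Pi.single (1 : Fin 3) (1 : ℤ)) (EuclideanSpace.single (0 : Fin 3) (1 : ℝ)) true x + Literature.Analysis.FluidPDE.Torus.stokesMode (Pi.single (2 : Fin 3) (1 : ℤ)) (EuclideanSpace.single (1 : Fin 3) (1 : ℝ)) true x + Literature.Analysis.FluidPDE.Torus.stokesMode (Pi.single (0 : Fin 3) (1 : ℤ)) (EuclideanSpace.single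 (2 : Fin 3) (1 : ℝ)) true x : EuclideanSpace ℝ (Fin 3))), (fun x : UnitAddTorus (Fin 3) => (Literature.Analysis.FluidPDE.Torus.stokesMode ![(0 : ℤ), 1, 1] (EuclideanSpace.single (0 : Fin 3) (1 : ℝ)) false x + Literature.Analysis.FluidPDE.Torus.stokesMode ![(1 : ℤ), 0, 1] (EuclideanSpace.single (1 : Fin 3) (1 : ℝ)) false x + Literature.Analysis.FluidPDE.Torus.stokesMode ![(1 : ℤ), 1, 0] (EuclideanSpace.single (2 : Fin 3) (1 : ℝ)) false x : EuclideanSpace ℝ (Fin 3)))] →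
      ∃ E : ℝ, 0 < E ∧ ∀ ν₀ m₀ : ℝ, 0 < ν₀ → 0 < m₀ →
        ∃ (s ν : ℝ) (μ : Measure (Torus.energySpace (Fin 3))), (s = 1 ∨ s = -1) ∧ 0 < ν ∧ ν < ν₀ ∧
          Torus.IsStationaryStatisticalSolution ν (fun x => s • b 2 x) μ ∧
          Integrable (fun u : Torus.energySpace (Fin 3) => ‖u‖ ^ 2) μ ∧ Torus.ensembleEnergy μ ≤ E ∧
          ∫ u, Torus.pairing (u : Lp (EuclideanSpace ℝ (Fin 3)) 2 (volume : Measure (UnitAddTorus (Fin 3)))) (fun x => s • b 2 x) ∂μ < m₀) :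
    ¬ NoScreening := by
  intro hNS
  obtain ⟨E, hE, hq⟩ := hq _ rfl
  obtain ⟨ν₀, m₀, hν₀, hm₀, H⟩ := polarInjectionFloor_of_noScreening hCov hMid hNS _ rfl E hE
  obtain ⟨s, ν, μ, hs, hν, hνlt, hstat, hint, hbd, hquiet⟩ := hq ν₀ m₀ hν₀ hm₀
  exact absurd (H s hs ν hν hνlt μ hstat hint hbd) (not_le.2 hquiet)

end Summit.AnomalousDissipation.AnomalousDissipation.Theorems.NoScreening.Negative

end
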